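import Summits.QuantumFields.YangMills.Theorems.LangevinControlUVFemtoCurvatureTwoPointCBulkDoubling
import Summits.QuantumFields.YangMills.Theorems.LangevinControlUVFemtoCurvatureTwoPointCDefsCore
import HarnessLib

/-!
# Route `LangevinControlUV`, crux `FemtoCurvatureTwoPointC` (stmt-QuantumFields-16204), line `birth` —
# skeleton stub `stub_varianceCeilingEvenBulk` (reshape v3, wave 6): V on EVEN window boxes in the bulk

This file CLOSES the registered skeleton stub `stub_varianceCeilingEvenBulk` of the birth skeleton
(`Cruxes/FemtoCurvatureTwoPointC/Lines/birth.lean`, reshape v3), proved verbatim and sorry-free.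

The lead split the crux's variance-ceiling stub V (the VARIANCE CEILING
`Var_{L,β}(P_0^{01}) = E(P_0·P_0) - E(P_0)² ≤ C'·u(8,β)²` of the `01`-plaquette field
`P_x = N - Re tr r.ρ(U_{x;01})` on window boxes `L ≥ 8` beyond a threshold, for a GIVEN bare-sized box
coupling `u`) into three pieces: V_even-bulk (even `L`, `log β ≤ L`; THIS file), V_even-corner and
V_odd. The even-bulk piece follows by pure real arithmetic from two inputs:

* the LANDED `u`-free even bulk variance ceiling `TorusGauge.varianceCeilingEven_bulk` (file
  `…CBulkDoubling`, p149639; itself assembled from the torus free-energy sandwich p146937 / p146095,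
  uniform doubling and the chessboard estimate): ONE `C = C(r)` with `Var_{L,β}(P_0^{01}) ≤ C/β²`
  for even `L ≥ 2`, `2 ≤ β`, `log β ≤ L`;
* the BARE SIZE clause of the R-bundle: `c₈ ≤ β·u(8,β)` for `β ≥ β₀`, with `0 < c₈`.

Proof (`variance_combine_bulk`). Witnesses: threshold `β₁ := max β₀ 2`, constant
`C' := max C 0 / c₈²`. For `β ≥ β₁`: `β ≥ 2 ≥ 1 > 0` and `β ≥ β₀`; `8 ≤ L` gives `2 ≤ L`. Squaring
the bare size (both sides non-negative) gives `c₈² ≤ β²·u(8,β)²`, i.e. `1/β² ≤ u(8,β)²/c₈²`, hence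
`Var ≤ C/β² ≤ (max C 0)/β² ≤ (max C 0)·u(8,β)²/c₈² = C'·u(8,β)²`. The window hypothesis and all
clauses of the R-bundle other than `0 < c₈` and bare size are unused; so is compact simplicity of `G`.

Nothing here is physics beyond the cited landed theorem; no named facts, no new definitions.
-/

set_option autoImplicit false

noncomputable section

open Filter Topology MeasureTheory
open Literature.MathematicalPhysics.QuantumFieldTheory

namespace Summit.QuantumFields.YangMills.Theorems.FemtoCurvatureTwoPointC

/-- **Variance combination in the bulk (pure real arithmetic).** From the bare size `c₈ ≤ β·t`
with `0 < c₈` and `1 ≤ β`, and a bare variance ceiling `V ≤ C₃·(β²)⁻¹`: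
`V ≤ (max C₃ 0 / c₈²)·t²`. Indeed `c₈² ≤ β²·t²` gives `(β²)⁻¹ ≤ t²/c₈²`, and `C₃ ≤ max C₃ 0`
with `0 ≤ max C₃ 0` lets the two bounds be chained (adapted from the private `variance_combine` of
`…CBirthVarianceBridge`, p141044). [folklore] -/
-- adapted from `variance_combine` of `…CBirthVarianceBridge` (p141044, private there)
private theorem variance_combine_bulk {V C₃ c₈ β t : ℝ} (hc₈ : 0 < c₈) (hβ : 1 ≤ β)
    (hbare : c₈ ≤ β * t) (hV : V ≤ C₃ * (β ^ 2)⁻¹) :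
    V ≤ max C₃ 0 / c₈ ^ 2 * t ^ 2 := by
  have hβpos : 0 < β := one_pos.trans_le hβ
  have hβ2 : 0 < β ^ 2 := pow_pos hβpos 2
  have hc2 : 0 < c₈ ^ 2 := pow_pos hc₈ 2
  -- square the bare size: `c₈² ≤ (β·t)² = β²·t²`
  have hsq : c₈ ^ 2 ≤ β ^ 2 * t ^ 2 := by
    rw [← mul_pow]
    exact pow_le_pow_left₀ hc₈.le hbare 2
  -- hence `1/β² ≤ t²/c₈²`
  have hinv : (β ^ 2)⁻¹ ≤ t ^ 2 / c₈ ^ 2 := by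
    rw [inv_eq_one_div, div_le_div_iff₀ hβ2 hc2]
    linarith [hsq]
  calc V ≤ C₃ * (β ^ 2)⁻¹ := hV
    _ ≤ max C₃ 0 * (β ^ 2)⁻¹ :=
        mul_le_mul_of_nonneg_right (le_max_left _ _) (inv_nonneg.mpr hβ2.le)
    _ ≤ max C₃ 0 * (t ^ 2 / c₈ ^ 2) := mul_le_mul_of_nonneg_left hinv (le_max_right _ _)
    _ = max C₃ 0 / c₈ ^ 2 * t ^ 2 := by ring

/-- **Skeleton stub V_even-bulk (line `birth`, reshape v3, wave 6; closes the registered stub).**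
For a compact simple Lie group `G`, a lattice representation `r`, and a GIVEN box coupling
`u : ℕ → ℝ → ℝ` with constants `u₀ β₀ κ₁ κ₂ κ₃ c C c₈` carrying the R-bundle (admissibility,
continuity, freezing, BARE SIZE `c₈ ≤ β·u(8,β)` for `β ≥ β₀` with `0 < c₈`, in-window comparability,
dyadic AF step law, diagonal matching on window boxes), there are `β₁ C'` such that on every EVEN
window box `L ≥ 8` in the bulk `log β ≤ L` beyond `β₁` the plaquette variance is bounded by the
running coupling squared: `E(P_0^{01}·P_0^{01}) - E(P_0^{01})² ≤ C'·u(8,β)²`, `P` the plaquette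
field `x i j U ↦ N - Re tr ρ(U_{x,ij})`, `E` the Wilson expectation at coupling `β`.
Witnesses: `β₁ = max β₀ 2`, `C' = max C_bulk 0 / c₈²` with `C_bulk` the constant of
`TorusGauge.varianceCeilingEven_bulk` (p149639). Only `0 < c₈` and the bare-size clause of the
R-bundle are used; the window hypothesis and compact simplicity are not used. -/
theorem stub_varianceCeilingEvenBulk :
    ∀ (G : Type) [Group G] [TopologicalSpace G] [IsTopologicalGroup G] [CompactSpace G]
        [MeasurableSpace G] [BorelSpace G], IsCompactSimpleLieGroup G →
        ∀ r : LatticeRep G, ∀ (u : ℕ → ℝ → ℝ) (u₀ β₀ κ₁ κ₂ κ₃ c C c₈ : ℝ),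
      (0 < u₀ ∧ 0 < c ∧ 0 < κ₁ ∧ 0 ≤ κ₃ ∧ 0 < c₈ ∧
        (∀ (L : ℕ) (β : ℝ), 8 ≤ L → β₀ ≤ β → 0 < u L β) ∧
        (∀ L : ℕ, 8 ≤ L → ContinuousOn (u L) (Set.Ici β₀)) ∧
        (∀ L : ℕ, 8 ≤ L → Filter.Tendsto (u L) Filter.atTop (nhds 0)) ∧
        (∀ β : ℝ, β₀ ≤ β → c₈ ≤ β * u 8 β) ∧
        (∀ (L L' : ℕ) (β : ℝ), β₀ ≤ β → 8 ≤ L → L ≤ L' → L' ≤ 2 * L →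
            (∀ M : ℕ, 8 ≤ M → M ≤ L → u M β ≤ u₀) → |(u L β)⁻¹ - (u L' β)⁻¹| ≤ κ₂) ∧
        (∀ (k m : ℕ) (β : ℝ), β₀ ≤ β → (∀ M : ℕ, 8 ≤ M → M ≤ 8 * 2 ^ (k + m) → u M β ≤ u₀) →
            κ₁ * m - κ₃ ≤ (u (8 * 2 ^ k) β)⁻¹ - (u (8 * 2 ^ (k + m)) β)⁻¹ ∧
              (u (8 * 2 ^ k) β)⁻¹ - (u (8 * 2 ^ (k + m)) β)⁻¹ ≤ κ₂ * m + κ₃) ∧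
        (∀ (L : ℕ) [NeZero L] (β : ℝ), β₀ ≤ β → 8 ≤ L →
            (∀ M : ℕ, 8 ≤ M → M ≤ L → u M β ≤ u₀) →
            ∀ (P : (Fin 4 → ZMod L) → Fin 4 → Fin 4 → GaugeConfig 4 L G → ℝ)
              (E : (GaugeConfig 4 L G → ℝ) → ℝ),
              (P = fun x i j U => (r.N : ℝ) - (r.ρ (plaquetteHolonomy U x i j)).trace.re) →
              (E = fun F => wilsonExpectation r.ρ β F) →
              c * u L β ^ 2 ≤
                ((L / 8 : ℕ) : ℝ) ^ 8 * (E (fun U => P 0 0 1 U * P (Pi.single (2 : Fin 4) ((L / 8 : ℕ) : ZMod L)) 0 1 U)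
                  - E (P 0 0 1) * E (P (Pi.single (2 : Fin 4) ((L / 8 : ℕ) : ZMod L)) 0 1)) ∧
              ((L / 8 : ℕ) : ℝ) ^ 8 * (E (fun U => P 0 0 1 U * P (Pi.single (2 : Fin 4) ((L / 8 : ℕ) : ZMod L)) 0 1 U)
                - E (P 0 0 1) * E (P (Pi.single (2 : Fin 4) ((L / 8 : ℕ) : ZMod L)) 0 1)) ≤ C * u L β ^ 2)) →
      ∃ (β₁ C' : ℝ),
        (∀ (L : ℕ) [NeZero L] (β : ℝ), β₁ ≤ β → 8 ≤ L → Even L → Real.log β ≤ L →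
            (∀ M : ℕ, 8 ≤ M → M ≤ L → u M β ≤ u₀) →
            ∀ (P : (Fin 4 → ZMod L) → Fin 4 → Fin 4 → GaugeConfig 4 L G → ℝ)
              (E : (GaugeConfig 4 L G → ℝ) → ℝ),
              (P = fun x i j U => (r.N : ℝ) - (r.ρ (plaquetteHolonomy U x i j)).trace.re) →
              (E = fun F => wilsonExpectation r.ρ β F) →
              E (fun U => P 0 0 1 U * P 0 0 1 U) - E (P 0 0 1) * E (P 0 0 1) ≤ C' * u 8 β ^ 2)  := by
  intro G _ _ _ _ _ _ _ r u u₀ β₀ κ₁ κ₂ κ₃ c C c₈ hR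
  obtain ⟨-, -, -, -, hc₈, -, -, -, hbare, -, -, -⟩ := hR
  -- the landed `u`-free even bulk ceiling `Var ≤ C_bulk / β²` (p149639)
  obtain ⟨Cb, hCb⟩ := TorusGauge.varianceCeilingEven_bulk r
  refine ⟨max β₀ 2, max Cb 0 / c₈ ^ 2, ?_⟩
  intro L _ β hβ hL hEven hlog _ P E hP hE
  have hβ₀ : β₀ ≤ β := (le_max_left _ _).trans hβ
  have hβ2 : (2 : ℝ) ≤ β := (le_max_right _ _).trans hβ
  have hβ1 : (1 : ℝ) ≤ β := by linarith
  have hL2 : 2 ≤ L := by omega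
  -- the bulk ceiling on the even box `L ≥ 2` at coupling `2 ≤ β`, `log β ≤ L`
  have hvar := hCb L hEven hL2 β hβ2 hlog P E hP hE
  -- the bare size at `β ≥ β₀`
  have hbs : c₈ ≤ β * u 8 β := hbare β hβ₀
  exact variance_combine_bulk hc₈ hβ1 hbs hvar

end Summit.QuantumFields.YangMills.Theorems.FemtoCurvatureTwoPointC

end
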